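import Mathlib.Topology.MetricSpace.HausdorffDimension
import Mathlib.Analysis.Calculus.ContDiff.RCLike
import Literature.Topology.FourManifolds.HomotopyBallSlice
import Literature.Topology.FourManifolds.KnotFraming
import Literature.Topology.FourManifolds.NeckCapping
import Literature.Topology.FourManifolds.OrientedHomogeneity
import Literature.Topology.FourManifolds.OrientedConnectedSumUniqueness
import Literature.Topology.FourManifolds.RadialDiffeomorph
import Literature.Topology.FourManifolds.ChartTransport
import Literature.Topology.FourManifolds.SmoothEmbeddingComp
import Literature.Topology.FourManifolds.CerfGammaFourProofs
import Literature.Topology.FourManifolds.BordismMerging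
import Literature.Topology.FourManifolds.ConnectedSum
import HarnessLib

/-!
# Transport of slice discs in punctured 4-manifolds along embeddings and connected sums

Topic `Literature/Topology/FourManifolds`, sibling proofs file of `HomotopyBallSlice.lean` for its
predicate `Literature.Topology.FourManifolds.Knot.IsSliceDiscIn K X e f` ("the restriction of
`f : ℝ² → X` to the closed unit disc is a smooth proper slice disc for the knot `K ⊂ S³` in
`X° = X ∖ e(B̊⁴)`, `e : ℝ⁴ ↪ X` a smooth ball"; Manolescu–Piccirillo 2023, Def. 2.1;
Freedman–Gompf–Morrison–Walker 2010, §1). Everything here is **proved**; no definition, no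
instance and no named fact is introduced (D-0026).

The results are the elementary transport properties of slice discs that the literature uses
silently when it says *"`K` is slice in `X`, hence in `X # N`"* or *"`X # ℂℙ² ≅ ℂℙ²`, thus `L` is
slice in `ℂℙ²`"* (Manolescu–Marengon–Sarkar–Willis 2023, proof of Cor. 6.15; Manolescu–Piccirillo
2023, §2: "if a knot is slice in the usual sense, then it is H-slice in any `W`"):

* `Knot.IsSliceDiscIn.comp_isSmoothEmbedding`, `Knot.IsSliceDiscIn.comp_diffeomorph` — slice data
  are carried along smooth embeddings `J : X ↪ Y` of 4-manifolds (in particular along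
  diffeomorphisms and along inclusions of open submanifolds): `(J ∘ e, J ∘ f)`.
* `Knot.IsSliceDiscIn.codRestrict` — slice data with images in an open subset `U ⊆ X` are slice
  data in the open submanifold `U`.
* `Knot.IsSliceDiscIn.congr_ball`, `exists_isSmoothEmbedding_eqOn_ball` — slice data only see
  the ball `e : ℝ⁴ ↪ X` on the closed unit ball, and `e` may be replaced by the bounded ball
  `e ∘ (32 • ballContraction)` (the identity on `B(0, 8) ⊇ 𝔻⁴`, range in `e(B(0, 32))`) without
  changing the disc or the removed ball `e(𝔻⁴)`.
* `exists_lt_norm_apply_notMem_range` — **dimension count**: a smooth map `f : ℝᵐ → X` into an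
  `n`-manifold, `m < n`, misses points `e v` of every equidimensional disc `e : ℝⁿ ↪ X` with `‖v‖`
  as large as desired (the set of parameters `v` hit by `f` has Hausdorff dimension `≤ m < n`;
  Mathlib's `dimH_image_le_of_locally_lipschitzOn`, `Real.dimH_of_nonempty_interior`).
* `Knot.IsSliceDiscIn.exists_notMem_range` — **slice data can be moved off any point**: in a
  connected 4-manifold, after shrinking the ball and applying a diffeomorphism preserving every
  orientation (Milnor's homogeneity lemma in the tree's oriented form,
  `exists_diffeomorph_apply_eq_forall_isOrientationPreserving`), the ball and the disc avoid a
  prescribed point `x₀`.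
* `Knot.IsSliceDiscIn.exists_of_isConnectedSum` — **sliceness survives connected sums**: if `K`
  is slice in the connected 4-manifold `X` (tree sense) and `P` is any connected sum of `X` with
  any manifold `N` (`IsConnectedSum`, Kervaire–Milnor's relation: `P ⊇ X ∖ {pt}` as an open
  submanifold), then `K` is slice in `P`.

## References

* C. Manolescu, L. Piccirillo, *From zero surgeries to candidates for exotic definite
  4-manifolds*, J. Lond. Math. Soc. 108 (2023), §2, Def. 2.1 and the remark following it.
  [cite: ManolescuPiccirillo2023, Def. 2.1]
* C. Manolescu, M. Marengon, S. Sarkar, M. Willis, *A generalization of Rasmussen's invariant,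
  with applications to surfaces in some four-manifolds*, Duke Math. J. 172 (2023), proof of
  Cor. 6.15 ("`X # ℂℙ² ≅ ℂℙ²` ... Thus, `L` is strongly H-slice in `ℂℙ²`").
  [cite: ManolescuMarengonSarkarWillis2023, proof of Cor. 6.15]
* J. Milnor, *Topology from the Differentiable Viewpoint* (1965), §4, Homogeneity Lemma.
  [cite: MilnorTDV1965, §4]
* M. Kervaire, J. Milnor, *Groups of homotopy spheres I*, Ann. of Math. 77 (1963), §2.
  [cite: KervaireMilnor1963, §2]

## Design notes

No definitions, no instances, no notation. Postcomposition of the ball with a smooth embedding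
uses the tree's `IsSmoothEmbedding.comp_of_isOpen_range` (`BordismMerging.lean`: a smooth
embedding precomposed with an OPEN smooth embedding is a smooth embedding; the ball is open by
invariance of domain, `isOpen_range_of_isSmoothEmbedding_disc`); the shrinking map
`32 • ballContraction` is used inside proofs only.
-/

noncomputable section

open scoped Manifold ContDiff Topology NNReal ENNReal
open Set Function Metric Module Filter

namespace Literature.Topology.FourManifolds

/-! ### Shrinking a ball -/

section Shrink

variable {n : ℕ} {X : Type*} [TopologicalSpace X] [ChartedSpace (EuclideanSpace ℝ (Fin n)) X]

/-- **Shrinking a ball.** For every smooth embedding `e : ℝⁿ ↪ X` of the model space into an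
`n`-manifold there is a smooth embedding `e' : ℝⁿ ↪ X` which AGREES with `e` on `B(0, 8) ⊇ 𝔻ⁿ`
and whose whole range lies in `e(B(0, 32))` — namely `e' = e ∘ (32 • ballContraction)`, with the
tree's ball contraction `ballContraction : ℝⁿ ≅ B(0, 1)` (`RadialDiffeomorph.lean`), which is the
homothety `w ↦ w / 32` on `B(0, 8)`. (Replacing the ball of slice data by `e'` changes neither the
removed ball `e(𝔻ⁿ)` nor the boundary sphere, but makes the range avoidable.) [folklore] -/
theorem exists_isSmoothEmbedding_eqOn_ball [IsManifold (𝓡 n) ∞ X] {e : EuclideanSpace ℝ (Fin n) → X}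
    (he : Manifold.IsSmoothEmbedding (𝓡 n) (𝓡 n) ∞ e) :
    ∃ e' : EuclideanSpace ℝ (Fin n) → X, Manifold.IsSmoothEmbedding (𝓡 n) (𝓡 n) ∞ e' ∧
      (∀ w, ‖w‖ < 8 → e' w = e w) ∧ range e' ⊆ e '' ball 0 32 := by
  set L : EuclideanSpace ℝ (Fin n) ≃L[ℝ] EuclideanSpace ℝ (Fin n) :=
    ContinuousLinearEquiv.equivOfInverse
      ((32 : ℝ) • ContinuousLinearMap.id ℝ (EuclideanSpace ℝ (Fin n)))
      ((32 : ℝ)⁻¹ • ContinuousLinearMap.id ℝ (EuclideanSpace ℝ (Fin n)))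
      (fun w => by simp [smul_smul]) (fun w => by simp [smul_smul]) with hL
  have hLw : ∀ w, L w = (32 : ℝ) • w := fun w => rfl
  have h1 : Manifold.IsSmoothEmbedding (𝓡 n) (𝓡 n) ∞
      (e ∘ (L : EuclideanSpace ℝ (Fin n) → EuclideanSpace ℝ (Fin n))) :=
    he.comp_diffeomorph L.toDiffeomorph
  have h2 := h1.comp_openPartialHomeomorph
    (ballContractionPartialHomeomorph :
      OpenPartialHomeomorph (EuclideanSpace ℝ (Fin n)) (EuclideanSpace ℝ (Fin n))) rfl
    (by
      rw [ballContractionPartialHomeomorph_coe, ballContractionPartialHomeomorph_source]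
      exact contDiff_ballContraction.contMDiff.contMDiffOn)
    (by
      rw [ballContractionPartialHomeomorph_symm_coe, ballContractionPartialHomeomorph_target]
      exact contDiffOn_ballContractionInv.contMDiffOn)
  rw [ballContractionPartialHomeomorph_coe] at h2
  refine ⟨(e ∘ (L : EuclideanSpace ℝ (Fin n) → EuclideanSpace ℝ (Fin n))) ∘ ballContraction, h2,
    fun w hw => ?_, ?_⟩
  · change e (L (ballContraction w)) = e w
    rw [hLw, ballContraction_eq_smul_of_norm_lt hw, smul_smul]
    norm_num
  · rintro _ ⟨w, rfl⟩
    refine ⟨L (ballContraction w), ?_, rfl⟩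
    rw [mem_ball_zero_iff, hLw, norm_smul, Real.norm_of_nonneg (by norm_num : (0 : ℝ) ≤ 32)]
    have := norm_ballContraction_lt_one w
    nlinarith

end Shrink

/-! ### Dimension count: a smooth image of `ℝᵐ` misses far-out points of every `n`-disc, `m < n` -/

section DimensionCount

variable {m n : ℕ} {X : Type*} [TopologicalSpace X] [ChartedSpace (EuclideanSpace ℝ (Fin n)) X]

/-- **A smooth `m`-dimensional image misses points of every equidimensional disc, arbitrarily far
out** (`m < n`). For a smooth embedding `e : ℝⁿ ↪ X` of the model space into an `n`-manifold and a
`C^∞` map `f : ℝᵐ → X`, `m < n`, and every `R`, there is `v` with `‖v‖ > R` and `e v ∉ f(ℝᵐ)`.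
Indeed the set of parameters `v` with `e v ∈ f(ℝᵐ)` is the image of the open set `f⁻¹(e(ℝⁿ))`
under the locally Lipschitz map `e⁻¹ ∘ f`, so it has Hausdorff dimension `≤ m`
(`dimH_image_le_of_locally_lipschitzOn`), while `{‖v‖ > R}` has dimension `n`
(`Real.dimH_of_nonempty_interior`). The easy case of Sard's theorem (Milnor, *Topology from the
Differentiable Viewpoint* (1965), §2–§3: a smooth image of a lower-dimensional manifold has
measure zero). [cite: MilnorTDV1965, §3] -/
theorem exists_lt_norm_apply_notMem_range [IsManifold (𝓡 n) ∞ X] (hmn : m < n)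
    {e : EuclideanSpace ℝ (Fin n) → X}
    (he : Manifold.IsSmoothEmbedding (𝓡 n) (𝓡 n) ∞ e) {f : EuclideanSpace ℝ (Fin m) → X}
    (hf : ContMDiff (𝓡 m) (𝓡 n) ∞ f) (R : ℝ) :
    ∃ v : EuclideanSpace ℝ (Fin n), R < ‖v‖ ∧ e v ∉ range f := by
  by_contra hcon
  push Not at hcon
  obtain ⟨Φ, hΦt, hΦe, hΦs, hΦc⟩ := exists_chart_of_isSmoothEmbedding he
  -- the set of parameters hit by `f` is a locally-Lipschitz image of an open subset of `ℝᵐ`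
  set T : Set (EuclideanSpace ℝ (Fin m)) := f ⁻¹' range e with hT
  set g : EuclideanSpace ℝ (Fin m) → EuclideanSpace ℝ (Fin n) := fun y => Φ (f y) with hg
  have hsub : {v : EuclideanSpace ℝ (Fin n) | R < ‖v‖} ⊆ g '' T := by
    intro v hv
    obtain ⟨y, hy⟩ := hcon v hv
    refine ⟨y, ?_, ?_⟩
    · change f y ∈ range e
      exact ⟨v, hy.symm⟩
    · change Φ (f y) = v
      rw [hy, ← hΦe]
      exact Φ.right_inv (by rw [hΦt]; exact mem_univ v)
  have hlip : ∀ y ∈ T, ∃ C : ℝ≥0, ∃ t ∈ 𝓝[T] y, LipschitzOnWith C g t := by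
    intro y hy
    have hfy : f y ∈ Φ.source := by rw [hΦs]; exact hy
    have h1 : ContMDiffAt (𝓡 m) (𝓡 n) ∞ g y :=
      (hΦc.contMDiffAt (Φ.open_source.mem_nhds hfy)).comp y (hf y)
    have h2 : ContDiffAt ℝ 1 g y := (contMDiffAt_iff_contDiffAt.1 h1).of_le (by norm_num)
    obtain ⟨C, t, ht, hC⟩ := h2.exists_lipschitzOnWith
    exact ⟨C, t, mem_nhdsWithin_of_mem_nhds ht, hC⟩
  have hdim : dimH (g '' T) ≤ m := by
    calc dimH (g '' T) ≤ dimH T := dimH_image_le_of_locally_lipschitzOn hlip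
      _ ≤ dimH (univ : Set (EuclideanSpace ℝ (Fin m))) := dimH_mono (subset_univ _)
      _ = m := by rw [Real.dimH_univ_eq_finrank, finrank_euclideanSpace_fin]
  have hopen : IsOpen {v : EuclideanSpace ℝ (Fin n) | R < ‖v‖} :=
    isOpen_lt continuous_const continuous_norm
  have hn : 0 < n := lt_of_le_of_lt (Nat.zero_le m) hmn
  have hne : ({v : EuclideanSpace ℝ (Fin n) | R < ‖v‖}).Nonempty := by
    refine ⟨EuclideanSpace.single (⟨0, hn⟩ : Fin n) (|R| + 1), ?_⟩
    change R < ‖EuclideanSpace.single (⟨0, hn⟩ : Fin n) (|R| + 1)‖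
    rw [PiLp.norm_single, Real.norm_eq_abs, abs_of_pos (by positivity)]
    linarith [le_abs_self R]
  have h4 : dimH {v : EuclideanSpace ℝ (Fin n) | R < ‖v‖} = n := by
    rw [Real.dimH_of_nonempty_interior (by rwa [hopen.interior_eq]), finrank_euclideanSpace_fin]
  have h5 := dimH_mono hsub
  rw [h4] at h5
  have h6 : (n : ℝ≥0∞) ≤ m := h5.trans hdim
  exact absurd (by exact_mod_cast h6) (not_le.mpr hmn)

end DimensionCount

namespace Knot

variable {K : Knot} {X : Type*} [TopologicalSpace X] [ChartedSpace (EuclideanSpace ℝ (Fin 4)) X]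
  {Y : Type*} [TopologicalSpace Y] [ChartedSpace (EuclideanSpace ℝ (Fin 4)) Y]
  {e : EuclideanSpace ℝ (Fin 4) → X} {f : EuclideanSpace ℝ (Fin 2) → X}

/-! ### Transport of slice data along smooth embeddings -/

/-- **Slice data are carried along smooth embeddings of 4-manifolds.** If `(e, f)` are slice data
for `K` in `X` (`K.IsSliceDiscIn X e f`) and `J : X → Y` is a smooth embedding of 4-manifolds
(e.g. a diffeomorphism, or the inclusion of an open submanifold), then `(J ∘ e, J ∘ f)` are slice
data for `K` in `Y`: the ball `J ∘ e` is a smooth embedding (`e` has open range by invariance of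
domain), the disc `J ∘ f` is smooth, injective and immersive on `𝔻²` (chain rule; an immersion has
injective differential), proper with respect to `(J ∘ e)(𝔻⁴) = J(e(𝔻⁴))` by injectivity of `J`,
and bounded by `(J ∘ e) ∘ K`. This is the step *"`K` is slice in `X ⊆ Y`, hence in `Y`"*.
[cite: ManolescuPiccirillo2023, Def. 2.1] -/
theorem IsSliceDiscIn.comp_isSmoothEmbedding [IsManifold (𝓡 4) ∞ X] [IsManifold (𝓡 4) ∞ Y]
    (h : K.IsSliceDiscIn X e f) {J : X → Y} (hJ : Manifold.IsSmoothEmbedding (𝓡 4) (𝓡 4) ∞ J) :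
    K.IsSliceDiscIn Y (J ∘ e) (J ∘ f) := by
  obtain ⟨he, hf, hinj, hmf, hproper, hbdry⟩ := h
  refine ⟨IsSmoothEmbedding.comp_of_isOpen_range hJ he (isOpen_range_of_isSmoothEmbedding_disc he),
    hJ.contMDiff.comp hf, hJ.isEmbedding.injective.comp_injOn hinj, fun x hx => ?_,
    fun x hx => ?_, fun x => by rw [comp_apply, hbdry x]; rfl⟩
  · have h1 : MDifferentiableAt (𝓡 2) (𝓡 4) f x := (hf x).mdifferentiableAt (by simp)
    have h2 : MDifferentiableAt (𝓡 4) (𝓡 4) J (f x) :=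
      (hJ.contMDiff (f x)).mdifferentiableAt (by simp)
    rw [mfderiv_comp x h2 h1]
    exact (Manifold.IsImmersionAt.mfderiv_injective (hJ.isImmersion.isImmersionAt (f x))
      (by simp)).comp (hmf x hx)
  · rintro ⟨v, hv, hfv⟩
    exact hproper x hx ⟨v, hv, hJ.isEmbedding.injective hfv⟩

/-- **Slice data are carried along diffeomorphisms.** [cite: ManolescuPiccirillo2023, Def. 2.1] -/
theorem IsSliceDiscIn.comp_diffeomorph [IsManifold (𝓡 4) ∞ X] [IsManifold (𝓡 4) ∞ Y]
    (h : K.IsSliceDiscIn X e f) (Φ : X ≃ₘ⟮𝓡 4, 𝓡 4⟯ Y) :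
    K.IsSliceDiscIn Y (Φ ∘ e) (Φ ∘ f) :=
  h.comp_isSmoothEmbedding Φ.isSmoothEmbedding'

/-- **Slice data with images in an open subset are slice data in the open submanifold.** If
`(e, f)` are slice data for `K` in `X` and the ball `e` and the map `f` take values in an open
subset `U ⊆ X`, then the corestrictions are slice data for `K` in `U` (corestriction of a smooth
embedding to an open submanifold, `Manifold.IsSmoothEmbedding.codRestrict_opens`; the manifold
derivative of a corestriction is that of the map, `mfderiv_codRestrict_opens_eq`).
[cite: ManolescuPiccirillo2023, Def. 2.1] -/
theorem IsSliceDiscIn.codRestrict [IsManifold (𝓡 4) ∞ X] (h : K.IsSliceDiscIn X e f)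
    (U : TopologicalSpace.Opens X) (heU : ∀ v, e v ∈ U) (hfU : ∀ y, f y ∈ U) :
    K.IsSliceDiscIn U (fun v => (⟨e v, heU v⟩ : U)) (fun y => (⟨f y, hfU y⟩ : U)) := by
  obtain ⟨he, hf, hinj, hmf, hproper, hbdry⟩ := h
  refine ⟨he.codRestrict_opens U heU, (ContMDiff.subtypeVal_comp_iff U _).1 hf,
    fun x hx y hy hxy => hinj hx hy (congrArg Subtype.val hxy), fun x hx => ?_, fun x hx => ?_,
    fun x => Subtype.ext (hbdry x)⟩
  · rw [mfderiv_codRestrict_opens_eq (f := f) (g := fun y => (⟨f y, hfU y⟩ : U)) (fun y => rfl)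
      ((hf x).mdifferentiableAt (by simp))]
    exact hmf x hx
  · rintro ⟨v, hv, hfv⟩
    exact hproper x hx ⟨v, hv, congrArg Subtype.val hfv⟩

/-! ### Changing the ball away from the unit ball -/

/-- **Slice data only see the ball on the closed unit ball.** If `(e, f)` are slice data for `K`
in `X` and `e'` is another smooth embedding `ℝ⁴ ↪ X` which agrees with `e` on the closed unit
ball, then `(e', f)` are slice data as well: the removed ball `e'(𝔻⁴) = e(𝔻⁴)` and the boundary
condition `f|_{S¹} = e' ∘ K = e ∘ K` (`K` takes values in `S³ ⊆ 𝔻⁴`) are unchanged.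
[cite: ManolescuPiccirillo2023, Def. 2.1] -/
theorem IsSliceDiscIn.congr_ball (h : K.IsSliceDiscIn X e f) {e' : EuclideanSpace ℝ (Fin 4) → X}
    (he' : Manifold.IsSmoothEmbedding (𝓡 4) (𝓡 4) ∞ e') (hee' : ∀ w, ‖w‖ ≤ 1 → e' w = e w) :
    K.IsSliceDiscIn X e' f := by
  obtain ⟨-, hf, hinj, hmf, hproper, hbdry⟩ := h
  have himg : e' '' closedBall 0 1 = e '' closedBall 0 1 := by
    refine Subset.antisymm ?_ ?_
    · rintro _ ⟨w, hw, rfl⟩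
      exact ⟨w, hw, (hee' w (mem_closedBall_zero_iff.1 hw)).symm⟩
    · rintro _ ⟨w, hw, rfl⟩
      exact ⟨w, hw, hee' w (mem_closedBall_zero_iff.1 hw)⟩
  refine ⟨he', hf, hinj, hmf, fun x hx => ?_, fun x => ?_⟩
  · rw [himg]
    exact hproper x hx
  · rw [hbdry x, hee' _ (by simp)]

/-! ### Moving slice data off a point -/

/-- **Slice data can be moved off any point of a connected 4-manifold.** Given slice data `(e, f)`
for `K` in the connected smooth 4-manifold `X` and a point `x₀`, there are a diffeomorphism `φ` of
`X` preserving EVERY smooth orientation of `X` and a smooth ball `e'` agreeing with `e` on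
`B(0, 8) ⊇ 𝔻⁴` such that `(φ ∘ e', φ ∘ f)` are slice data for `K` in `X` whose ball and disc both
miss `x₀`. Proof: shrink the ball (`exists_isSmoothEmbedding_eqOn_ball`: `range e' ⊆ e(B(0,32))`);
by the dimension count (`exists_lt_norm_apply_notMem_range`) some `x₁ = e v`, `‖v‖ > 32`, is not
on `f(ℝ²)`, nor in `e'(ℝ⁴)`; Milnor's homogeneity lemma in the oriented form of the tree
(`exists_diffeomorph_apply_eq_forall_isOrientationPreserving`) moves `x₁` to `x₀`.
[cite: MilnorTDV1965, §4, Homogeneity Lemma] -/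
theorem IsSliceDiscIn.exists_notMem_range [T2Space X] [IsManifold (𝓡 4) ∞ X] [ConnectedSpace X]
    (h : K.IsSliceDiscIn X e f) (x₀ : X) :
    ∃ (φ : X ≃ₘ⟮𝓡 4, 𝓡 4⟯ X) (e' : EuclideanSpace ℝ (Fin 4) → X),
      (∀ oX : SmoothOrientation (𝓡 4) X, φ.IsOrientationPreserving oX oX) ∧
      K.IsSliceDiscIn X (φ ∘ e') (φ ∘ f) ∧ (∀ w, ‖w‖ < 8 → e' w = e w) ∧
      x₀ ∉ range (φ ∘ e') ∧ x₀ ∉ range (φ ∘ f) := by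
  obtain ⟨e', he', hee', hr⟩ := exists_isSmoothEmbedding_eqOn_ball h.isSmoothEmbedding
  obtain ⟨v, hv, hvf⟩ := exists_lt_norm_apply_notMem_range (m := 2) (n := 4) (X := X)
    (by norm_num) h.isSmoothEmbedding h.contMDiff 32
  obtain ⟨φ, hφ, hφo⟩ :=
    exists_diffeomorph_apply_eq_forall_isOrientationPreserving (n := 4) (e v) x₀
  refine ⟨φ, e', hφo, (h.congr_ball he' fun w hw => hee' w (by linarith)).comp_diffeomorph φ,
    hee', ?_, ?_⟩
  · rintro ⟨w, hw⟩
    rw [← hφ] at hw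
    obtain ⟨u, hu, hu'⟩ := hr ⟨w, rfl⟩
    have h1 : u = v := h.isSmoothEmbedding.isEmbedding.injective (hu'.trans (φ.injective hw))
    rw [mem_ball_zero_iff, h1] at hu
    linarith
  · rintro ⟨y, hy⟩
    rw [← hφ] at hy
    exact hvf ⟨y, φ.injective hy⟩

/-! ### Sliceness survives connected sums -/

/-- **A knot slice in `X` is slice in every connected sum `X # N`.** Let `(e, f)` be slice data
for `K` in the connected smooth 4-manifold `X`, and let `P` be a connected sum of `X` with any
manifold `N` in the tree's relational sense (`IsConnectedSum (𝓡 4) (𝓡 4) IN X N P`: `P` is the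
open gluing of `X ∖ {i₁ 0}` and `N ∖ {i₂ 0}` along Kervaire–Milnor's relation, so `X ∖ {i₁ 0}`
embeds in `P` as an open submanifold by a smooth embedding `jA`). Then `K` is slice in `P`: move
the data off the centre `i₁ 0` (`exists_notMem_range`), corestrict to the open submanifold
`X ∖ {i₁ 0}` (`codRestrict`) and compose with `jA` (`comp_isSmoothEmbedding`). This is the remark
that sliceness in `X°` only sees `X` minus a point, used e.g. in "`X # ℂℙ² ≅ ℂℙ²` ... thus `L` is
strongly slice in `ℂℙ²`". [cite: ManolescuMarengonSarkarWillis2023, proof of Cor. 6.15]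
[cite: KervaireMilnor1963, §2] -/
theorem IsSliceDiscIn.exists_of_isConnectedSum [T2Space X] [IsManifold (𝓡 4) ∞ X]
    [ConnectedSpace X] {EN HN : Type*} [NormedAddCommGroup EN] [NormedSpace ℝ EN]
    [TopologicalSpace HN] {IN : ModelWithCorners ℝ EN HN} {N : Type*} [TopologicalSpace N]
    [T2Space N] [ChartedSpace HN N] {P : Type*} [TopologicalSpace P]
    [ChartedSpace (EuclideanSpace ℝ (Fin 4)) P]
    [IsManifold (𝓡 4) ∞ P] (h : K.IsSliceDiscIn X e f)
    (hP : IsConnectedSum (𝓡 4) (𝓡 4) IN X N P) :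
    ∃ (e' : EuclideanSpace ℝ (Fin 4) → P) (f' : EuclideanSpace ℝ (Fin 2) → P),
      K.IsSliceDiscIn P e' f' := by
  obtain ⟨i₁, i₂, -, -, jA, jB, hA, -, -, -, -, -⟩ := hP
  obtain ⟨φ, e', -, hφ, -, he0, hf0⟩ := h.exists_notMem_range (i₁ 0)
  have heU : ∀ v, (φ ∘ e') v ∈ puncture i₁ := fun v hv => he0 ⟨v, hv⟩
  have hfU : ∀ y, (φ ∘ f) y ∈ puncture i₁ := fun y hy => hf0 ⟨y, hy⟩
  exact ⟨_, _, (hφ.codRestrict (puncture i₁) heU hfU).comp_isSmoothEmbedding hA⟩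

end Knot

end Literature.Topology.FourManifolds

end
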